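import Summits.Ventures.PercRepro.Matrix4
import Summits.Ventures.PercRepro.LemmaBPlusMask

/-!
# From the adjacency-matrix census to one kernel Boolean per upper triangle

typer-2's `C005UpTo_of_upper` (Matrix4.lean) reduces «C-005 / C-011 on every multigraph with `≤ 4`
vertices at every `p`» to the census over the `64` upper triangles `b : Fin 6 → Bool`:
`∀ b, ∀ m injective, 0 ≤ (graphOf (matrixOf4 b)).cubeSumC011Z m`.  Here that census becomes 64
kernel Booleans:

* `graphFin b : MultiGraph (Fin 4) (Fin k_b)` re-indexes the edges of `graphOf (matrixOf4 b)` by a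
  COMPUTABLE bijection (`edgeList b`, `List.Nodup.getEquivOfForallMemList`) so that the kernel works
  on `Fin k` edges (`cubeSumC011_graphFin`, through `cubeSumC011_mapEdges`);
* `cubeSumC011_eq_faceSlackZ_top`: the full-cube class sum is the face slack of the top face
  `[⊥, ⊤]`, hence (`faceSlackZ_eq_table`) a row-table computation; **`topCheck G : Bool`** checks
  every injective marking on codes, and **`cubeSumC011_nonneg_of_topCheck`** is the bridge back.

`LemmaBPlusUpTo4A.lean` … `…D.lean` decide `topCheck g_n = true` for the 64 triangles (`g_n` the
explicit graph of triangle `n`, `graphFin (cfgOf 6 n) = g_n`); `LemmaBPlusUpTo4.lean` assembles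
`LemmaBPlusSimpleInjUpTo 4`, `C005UpTo 4`, `C011UpTo 4`.
-/

namespace PercRepro

namespace MultiGraph

/-! ### Upper triangles and their graphs -/

/-- `matrixOf4` reads back its triangle along `pair4` (= typer-2's `upperPos4`). -/
theorem matrixOf4_pair4 (b : Fin 6 → Bool) (a : Fin 6) :
    matrixOf4 b (pair4 a).1 (pair4 a).2 = b a := by
  fin_cases a <;> rfl

/-- The pairs of `pair4` are increasing. -/
theorem pair4_lt (a : Fin 6) : (pair4 a).1 < (pair4 a).2 := by
  fin_cases a <;> decide

/-- Every increasing pair is a `pair4`. -/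
theorem exists_pair4 (ij : Fin 4 × Fin 4) (h : ij.1 < ij.2) : ∃ a : Fin 6, pair4 a = ij := by
  revert ij
  decide

/-- `pair4` is injective. -/
theorem pair4_injective : Function.Injective pair4 := by
  intro a a' h
  revert a a'
  decide

/-- The edges of `graphOf (matrixOf4 b)` as a list (the `pair4` order). -/
def edgeList (b : Fin 6 → Bool) : List (EdgesOf (matrixOf4 b)) :=
  (List.finRange 6).filterMap fun a =>
    if h : b a = true then some ⟨pair4 a, pair4_lt a, (matrixOf4_pair4 b a).trans h⟩ else none

/-- The edge list has no duplicates. -/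
theorem edgeList_nodup (b : Fin 6 → Bool) : (edgeList b).Nodup := by
  refine List.Nodup.filterMap ?_ (List.nodup_finRange 6)
  intro a a' x ha ha'
  split_ifs at ha ha' with h1 h2
  · simp only [Option.mem_def, Option.some.injEq] at ha ha'
    have := congrArg Subtype.val ha
    have := congrArg Subtype.val ha'
    exact pair4_injective (by simp_all)
  all_goals simp at ha ha'

/-- The edge list is complete. -/
theorem mem_edgeList (b : Fin 6 → Bool) (x : EdgesOf (matrixOf4 b)) : x ∈ edgeList b := by
  obtain ⟨ij, hlt, hA⟩ := x
  obtain ⟨a, rfl⟩ := exists_pair4 ij hlt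
  rw [matrixOf4_pair4] at hA
  unfold edgeList
  rw [List.mem_filterMap]
  exact ⟨a, List.mem_finRange a, by simp [hA]⟩

/-- The computable bijection `Fin k_b ≃ EdgesOf (matrixOf4 b)` (`List.get` on the edge list). -/
def triEdgeEquiv (b : Fin 6 → Bool) : Fin (edgeList b).length ≃ EdgesOf (matrixOf4 b) :=
  List.Nodup.getEquivOfForallMemList (edgeList b) (edgeList_nodup b) (mem_edgeList b)

/-- The graph of the triangle `b` on `Fin k_b` edges. -/
def graphFin (b : Fin 6 → Bool) : MultiGraph (Fin 4) (Fin (edgeList b).length) :=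
  (graphOf (matrixOf4 b)).mapEdges (triEdgeEquiv b).symm

/-- The class sum of `graphFin b` is that of `graphOf (matrixOf4 b)`. -/
theorem cubeSumC011_graphFin (b : Fin 6 → Bool) (m : Fin 4 → Fin 4) :
    (graphFin b).cubeSumC011 m = (graphOf (matrixOf4 b)).cubeSumC011 m :=
  (graphOf (matrixOf4 b)).cubeSumC011_mapEdges (triEdgeEquiv b).symm m

/-! ### The full-cube class sum is the top face slack -/

section TopFace

variable {V E : Type*} (G : MultiGraph V E) [DecidableEq V] [Fintype V] [Fintype E] [DecidableEq E]

omit [DecidableEq V] [Fintype V] [Fintype E] [DecidableEq E] in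
/-- The antipode in the top face is the complement. -/
theorem antipode_top_bot (ω : Config E) : antipode ⊤ ⊥ ω = ωᶜ := by
  funext e
  simp [antipode]

/-- **The full-cube class sum `CS(G, m)` is the face slack of `[⊥, ⊤]`.** -/
theorem cubeSumC011_eq_faceSlackZ_top (m : Fin 4 → V) :
    G.cubeSumC011 m = (G.faceSlackZ m ⊤ ⊥ : ℝ) := by
  unfold cubeSumC011 cubeSum faceSlackZ
  rw [Finset.sum_filter]
  push_cast
  refine Finset.sum_congr rfl fun ω _ => ?_
  rw [if_pos ⟨bot_le, le_top⟩, antipode_top_bot, phiPlusKernelZ_cast, row4D_eq_row4, row4D_eq_row4]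

end TopFace

/-! ### The kernel Boolean of a graph on `Fin 4` with `Fin k` edges -/

section TopCheck

variable {k : ℕ} (G : MultiGraph (Fin 4) (Fin k))

/-- The all-open code is the top configuration. -/
theorem cfgOf_top : cfgOf k (2 ^ k - 1) = ⊤ := by
  funext e
  simp [cfgOf, Nat.testBit_two_pow_sub_one, e.isLt]

/-- The code `0` is the bottom configuration. -/
theorem cfgOf_bot : cfgOf k 0 = ⊥ := by
  funext e
  simp [cfgOf]

/-- **The kernel Boolean**: for every injective marking, the top face `[⊥, ⊤]` has score ≥ size
(fast row table once per marking, codes only). -/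
def topCheck : Bool :=
  decide (∀ m : Fin 4 → Fin 4, Function.Injective m →
    withLitB (G.rowTableM m) (fun T =>
      decide (faceSizeM k (2 ^ k - 1) 0 ≤ faceScoreT k T (2 ^ k - 1) 0)) = true)

/-- **From the kernel Boolean to the class sums**: `topCheck G = true` gives `0 ≤ CS(G, m)` for
every injective marking `m`. -/
theorem cubeSumC011_nonneg_of_topCheck (h : G.topCheck = true) (m : Fin 4 → Fin 4)
    (hm : Function.Injective m) : 0 ≤ G.cubeSumC011 m := by
  unfold topCheck at h
  rw [decide_eq_true_iff] at h
  have h1 := h m hm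
  rw [withLitB_eq, decide_eq_true_iff, rowTableM_eq] at h1
  have hk : 2 ^ k - 1 < 2 ^ k := Nat.sub_lt (by positivity) one_pos
  have h2 := G.faceSlackZ_eq_table m ⟨2 ^ k - 1, hk⟩ ⟨0, by positivity⟩
  simp only [cfgOf_top, cfgOf_bot] at h2
  rw [G.cubeSumC011_eq_faceSlackZ_top, h2]
  have : (faceSizeM k (2 ^ k - 1) 0 : ℤ) ≤ faceScoreT k (G.rowTable m) (2 ^ k - 1) 0 := by
    exact_mod_cast h1
  have : (0 : ℤ) ≤ (faceScoreT k (G.rowTable m) (2 ^ k - 1) 0 : ℤ) - faceSizeM k (2 ^ k - 1) 0 := by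
    linarith
  exact_mod_cast this

end TopCheck

end MultiGraph

end PercRepro
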